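import Summits.BirchSwinnertonDyer.BirchSwinnertonDyer.Theorems.ClassRecordThreeEulerHalvesAtThreeCarrierLocalE0Completion
import Summits.BirchSwinnertonDyer.BirchSwinnertonDyer.Theorems.Rank1ResidualJetStringentTransport
import Literature.NumberTheory.EllipticCurves.CMPointsIdentityComponentLabel
import HarnessLib

/-!
# The two LOCAL E₀-inputs (T), (C) at a CARRIER prime over an UNRAMIFIED place — GLOBAL forms on `L`-points
# (cell `bsd-stepL`, seat `bsd-stepL-tam3-p1` g18, LINE OWNER of crux 19109 `EulerHalvesAtThree`; `--supports stmt-BirchSwinnertonDyer-19109 --as helper`;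
# companion of `…CarrierLocalE0Completion`, the local core of `stub_carrierLocalE0AtThree` of `Lines/inert.lean` r17)

SETTING as in `…CarrierLocalE0Completion`: `W/ℚ` globally minimal, `L` a number field, `w ∣ q` a finite place of `L` UNRAMIFIED over `ℚ`
(`¬ (q)𝓞_L ≤ w²` at `w`), `3 ∣ c_q(W/ℚ_q)` (a carrier). That file proves, over the completion `L_w`, `c_w = c_q`, (C_w) `c_q • Q ∈ E₀(L_w)` and (T_w)
`E(L_w) = ι E(ℚ_q) + E₀(L_w)`. THIS FILE reads them on `L`-points for the model `W` at `w` (`placeIntModel`, the currency of the CM-family labels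
and of `ShimuraWalk.carrierLabelsE0Prime_of_galTrivial_of_kills_of_auxLevel`):
* `hasNonsingularReduction_placeIntModel_iff_mapPoint_mem` — **`E₀(L)_w = E(L) ∩ E₀(L_w)`** (transport of `E₀` along `L → L_w`, the tree's
  `hasNonsingularReduction_some_iff_of_ringHom`, and the `𝓞_w`-model of the minimal `W_L ⊗ L_w`);
* `hasNonsingularReduction_localTamagawaNumber_nsmul` — **(C) `c_q • P ∈ E₀(L)_w`**;
* `galAdicCompletionMap_adicCompletionOfLiesOver` — the continuous extension `τ_w : L_w → L_w` of `τ ∈ Aut_ℚ(L)` fixing `w` (the tree's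
  `galAdicCompletionMap`, Cassels–Fröhlich VII §1.1) FIXES `ι(ℚ_q)` pointwise (it fixes the dense `ℚ`);
* `hasNonsingularReduction_pointGalHom_sub` — **(T) `τ P − P ∈ E₀(L)_w`**: writing the image of `P` as `ι Q₀ + R` by (T_w), `τ_w` fixes `ι Q₀`
  and preserves `E₀(L_w)` (it preserves `𝓞_w` and the rational equation), so `τ P − P ↦ τ_w R − R ∈ E₀(L_w)`.
HONEST FRAMING: THEOREMS ONLY; no definition, no named fact, no `sorry`; nothing about any CM point; no item closes; 19109 OPEN; BSD is proved for
no curve (T7). References (locators only): [cite: SilvermanAEC2009, VII §2 Prop. 2.1, Thm. VII.6.1] [cite: SilvermanATAEC1994, IV Cor. 9.2 (d)]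
[cite: CasselsFrohlichANT1967, Ch. VII §1.1 (σ_w : L_w → L_{σw})]. presearch: n/a (assembly over the companion file and tree theorems).
Axioms: `propext`, `Classical.choice`, `Quot.sound`.
-/

set_option autoImplicit false
set_option linter.dupNamespace false

noncomputable section

open scoped Classical NumberField

namespace Summit.BirchSwinnertonDyer.BirchSwinnertonDyer.Theorems.CarrierLocalE0

open WeierstrassCurve IsDedekindDomain NumberField Literature.NumberTheory.EllipticCurves
  Literature.NumberTheory.DiophantineGeometry Literature.NumberTheory.Automorphic IsLocalRing
  Literature.NumberTheory.GaloisRepresentations Summit.BirchSwinnertonDyer.Rank1Residual.X11b.Three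

variable (W : WeierstrassCurve ℚ) [W.IsElliptic] [W.IsGloballyMinimal]
  {L : Type} [Field L] [NumberField L] (w : HeightOneSpectrum (𝓞 L))

/-! ### (T) and (C) on `L`-points at `w` for the model `W` -/

omit [W.IsElliptic] in
/-- The `𝓞_w`-model of `W_L ⊗ L_w` induced by `placeIntModel W L w` along `L → L_w` (coefficients: the images of those of `W`). [folklore] -/
theorem exists_model_placeIntModel_map :
    ∃ (φ : (w.valuation L).valuationSubring →+* w.adicCompletionIntegers L),
      (∀ a, algebraMap (w.adicCompletionIntegers L) (w.adicCompletion L) (φ a) =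
        algebraMap L (w.adicCompletion L) (algebraMap (w.valuation L).valuationSubring L a)) ∧
      (W.baseChange L).baseChange (w.adicCompletion L) = ((placeIntModel W L w).map φ).baseChange (w.adicCompletion L) := by
  classical
  have hf : ∀ z : L, (w.valuation L) z ≤ 1 ↔ Valued.v (algebraMap L (w.adicCompletion L) z) ≤ 1 := fun z ↦ by
    rw [HeightOneSpectrum.algebraMap_adicCompletion, Function.comp_apply, Algebra.algebraMap_self_apply,
      HeightOneSpectrum.adicCompletion.valued_coe]
  let φ : (w.valuation L).valuationSubring →+* w.adicCompletionIntegers L :=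
    { toFun := fun a ↦ ⟨algebraMap L (w.adicCompletion L) (a : L),
        (HeightOneSpectrum.mem_adicCompletionIntegers _ _ _).mpr
          ((hf (a : L)).mp ((Valuation.mem_valuationSubring_iff _ _).mp a.2))⟩
      map_one' := Subtype.ext (map_one _)
      map_mul' := fun a b ↦ Subtype.ext (map_mul _ (a : L) (b : L))
      map_zero' := Subtype.ext (map_zero _)
      map_add' := fun a b ↦ Subtype.ext (map_add _ (a : L) (b : L)) }
  refine ⟨φ, fun _ ↦ rfl, ?_⟩
  ext <;> rfl

/-- **`E₀(L)_w` is `E(L) ∩ E₀(L_w)`**: an `L`-point of `W_L` has nonsingular reduction at `w` (on the model `W`, `placeIntModel`) iff its image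
in `E(L_w)` lies in the good-reduction subgroup of the minimal `W_L ⊗ L_w` (`w` unramified over `ℚ`). [cite: SilvermanAEC2009, VII §2 Prop. 2.1] -/
theorem hasNonsingularReduction_placeIntModel_iff_mapPoint_mem
    (he : ¬ (w.under (𝓞 ℚ)).asIdeal.map (algebraMap (𝓞 ℚ) (𝓞 L)) ≤ w.asIdeal ^ 2)
    (P : (W.baseChange L).toAffine.Point) :
    haveI := isMinimal_baseChange_adicCompletion_of_unramified W w he
    (placeIntModel W L w).HasNonsingularReduction (K := L) P ↔
      mapPoint (algebraMap L (w.adicCompletion L)) rfl P ∈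
        ((W.baseChange L).baseChange (w.adicCompletion L)).goodReductionSubgroup (w.adicCompletionIntegers L) := by
  classical
  haveI := isMinimal_baseChange_adicCompletion_of_unramified W w he
  obtain ⟨φ, hφ, hY⟩ := exists_model_placeIntModel_map W w
  have hf : ∀ z : L, (w.valuation L) z ≤ 1 ↔ Valued.v (algebraMap L (w.adicCompletion L) z) ≤ 1 := fun z ↦ by
    rw [HeightOneSpectrum.algebraMap_adicCompletion, Function.comp_apply, Algebra.algebraMap_self_apply,
      HeightOneSpectrum.adicCompletion.valued_coe]
  refine Iff.trans ?_ (Summit.BirchSwinnertonDyer.Rank1Residual.X11b.Three.JetchevKummer.mem_goodReductionSubgroup_iff_hasNonsingularReduction_congrEquiv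
    (W.baseChange L) (w.adicCompletion L) (w.adicCompletionIntegers L) _ hY _).symm
  rcases P with _ | ⟨x, y, hxy⟩
  · have h0 : Affine.Point.congrEquiv hY
        (mapPoint (algebraMap L (w.adicCompletion L)) rfl (0 : (W.baseChange L).toAffine.Point)) = 0 := by
      rw [mapPoint_zero]; exact Affine.Point.congrEquiv_zero hY
    exact iff_of_true (WeierstrassCurve.hasNonsingularReduction_zero (K := L) (W := placeIntModel W L w))
      ((congrArg (((placeIntModel W L w).map φ).HasNonsingularReduction (K := w.adicCompletion L)) h0).mpr
        (WeierstrassCurve.hasNonsingularReduction_zero (K := w.adicCompletion L) (W := (placeIntModel W L w).map φ)))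
  · have h1 : Affine.Point.congrEquiv hY (mapPoint (algebraMap L (w.adicCompletion L)) rfl (.some x y hxy)) =
        .some (algebraMap L (w.adicCompletion L) x) (algebraMap L (w.adicCompletion L) y)
          (hY ▸ (Affine.map_nonsingular (W := (W.baseChange L)) (algebraMap L (w.adicCompletion L)).injective x y).mpr hxy) := by
      rw [mapPoint_some]; exact Affine.Point.congrEquiv_some hY _
    exact (hasNonsingularReduction_some_iff_of_ringHom (valuation_integers_valuationSubring _)
      (HeightOneSpectrum.adicCompletionIntegers.integers L w) (algebraMap L (w.adicCompletion L)) φ hφ hf rfl _ _).symm.trans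
      (Iff.of_eq (congrArg _ h1.symm))

/-- **(C) `c_q • P ∈ E₀(L)_w`** for every `P ∈ E(L)` — `w ∣ q` unramified, `3 ∣ c_q(W/ℚ_q)`. [cite: SilvermanAEC2009, Thm. VII.6.1]
[cite: SilvermanATAEC1994, IV Cor. 9.2 (d)] -/
theorem hasNonsingularReduction_localTamagawaNumber_nsmul (q : ℕ) [Fact q.Prime]
    (hqw : ((q : ℕ) : 𝓞 L) ∈ w.asIdeal)
    (he : ¬ (w.under (𝓞 ℚ)).asIdeal.map (algebraMap (𝓞 ℚ) (𝓞 L)) ≤ w.asIdeal ^ 2)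
    (h3 : 3 ∣ (W.baseChange ℚ_[q]).localTamagawaNumber ℤ_[q]) (P : (W.baseChange L).toAffine.Point) :
    (placeIntModel W L w).HasNonsingularReduction (K := L) ((W.baseChange ℚ_[q]).localTamagawaNumber ℤ_[q] • P) := by
  rw [hasNonsingularReduction_placeIntModel_iff_mapPoint_mem W w he, map_nsmul]
  exact localTamagawaNumber_nsmul_mem_goodReductionSubgroup W w q hqw he h3 _

/-- The continuous extension `τ_w` of `τ ∈ Aut_ℚ(L)` fixing `w` FIXES the image of `ℚ_q` pointwise (it fixes `ℚ`, which is dense, and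
both maps are continuous). [cite: CasselsFrohlichANT1967, Ch. VII §1.1] -/
theorem galAdicCompletionMap_adicCompletionOfLiesOver (τ : L ≃ₐ[ℚ] L) (hτ : τ • w = w)
    (y : (w.under (𝓞 ℚ)).adicCompletion ℚ) :
    haveI : w.asIdeal.LiesOver (w.under (𝓞 ℚ)).asIdeal := ⟨rfl⟩
    galAdicCompletionMap τ hτ (adicCompletionOfLiesOver ℚ L (w.under (𝓞 ℚ)) w y) =
      adicCompletionOfLiesOver ℚ L (w.under (𝓞 ℚ)) w y := by
  haveI : w.asIdeal.LiesOver (w.under (𝓞 ℚ)).asIdeal := ⟨rfl⟩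
  have key := HeightOneSpectrum.adicCompletion.ext_of_coe (L := ℚ) (w.under (𝓞 ℚ))
    (f := fun y ↦ galAdicCompletionMap τ hτ (adicCompletionOfLiesOver ℚ L (w.under (𝓞 ℚ)) w y))
    (f' := fun y ↦ adicCompletionOfLiesOver ℚ L (w.under (𝓞 ℚ)) w y)
    ((continuous_galAdicCompletionMap L τ hτ).comp (continuous_adicCompletionOfLiesOver ℚ L _ w))
    (continuous_adicCompletionOfLiesOver ℚ L _ w) (fun x ↦ by
      rw [adicCompletionOfLiesOver_coe]
      exact galAdicCompletionMap_algebraMap ℚ τ hτ x)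
  exact congrFun key y

/-- **(T) every `τ ∈ Aut_ℚ(L)` fixing `w` acts trivially on `E(L) ∕ E₀(L)_w`** — `τ P − P ∈ E₀(L)_w` — for `w ∣ q` unramified, `3 ∣ c_q(W/ℚ_q)`:
in `E(L_w) = ι E(ℚ_q) + E₀(L_w)` write the image of `P` as `ι Q₀ + R`; the continuous extension `τ_w` fixes `ι Q₀` and preserves `E₀(L_w)`
(it preserves `𝓞_w` and the rational equation `W`), so `τ P − P ↦ τ_w R − R ∈ E₀(L_w)`. [cite: SilvermanAEC2009, Thm. VII.6.1, VII §2 Prop. 2.1]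
[cite: CasselsFrohlichANT1967, Ch. VII §1.1] -/
theorem hasNonsingularReduction_pointGalHom_sub (q : ℕ) [Fact q.Prime]
    (hqw : ((q : ℕ) : 𝓞 L) ∈ w.asIdeal)
    (he : ¬ (w.under (𝓞 ℚ)).asIdeal.map (algebraMap (𝓞 ℚ) (𝓞 L)) ≤ w.asIdeal ^ 2)
    (h3 : 3 ∣ (W.baseChange ℚ_[q]).localTamagawaNumber ℤ_[q])
    (τ : L ≃ₐ[ℚ] L) (hτ : τ • w = w) (P : (W.baseChange L).toAffine.Point) :
    (placeIntModel W L w).HasNonsingularReduction (K := L) (pointGalHom W L τ P - P) := by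
  classical
  haveI : w.asIdeal.LiesOver (w.under (𝓞 ℚ)).asIdeal := ⟨rfl⟩
  haveI hminY := isMinimal_baseChange_adicCompletion_of_unramified W w he
  rw [hasNonsingularReduction_placeIntModel_iff_mapPoint_mem W w he, map_sub]
  -- the transport `T = (τ_w)_*` on `E(L_w)`
  set Y := (W.baseChange L).baseChange (w.adicCompletion L) with hYdef
  set τw := galAdicCompletionEquiv (L := L) τ hτ with hτw
  have hfix : ∀ r : ℚ, (τw : w.adicCompletion L →+* w.adicCompletion L)
      (algebraMap L (w.adicCompletion L) (algebraMap ℚ L r)) = algebraMap L (w.adicCompletion L) (algebraMap ℚ L r) :=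
    fun r ↦ galAdicCompletionMap_algebraMap ℚ τ hτ r
  have hT : Y.map (τw : w.adicCompletion L →+* w.adicCompletion L) = Y := by
    rw [hYdef, WeierstrassCurve.baseChange, WeierstrassCurve.baseChange, WeierstrassCurve.map_map, WeierstrassCurve.map_map]
    have hcomp : ((τw : w.adicCompletion L →+* w.adicCompletion L).comp
        ((algebraMap L (w.adicCompletion L)).comp (algebraMap ℚ L))) =
        (algebraMap L (w.adicCompletion L)).comp (algebraMap ℚ L) :=
      RingHom.ext fun r ↦ hfix r
    exact congrArg (fun f : ℚ →+* w.adicCompletion L ↦ W.map f) hcomp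
  -- `T` preserves `E₀(L_w)`
  obtain ⟨ψ, hψ⟩ : ∃ ψ : w.adicCompletionIntegers L ≃+* w.adicCompletionIntegers L,
      ∀ r, (τw : w.adicCompletion L →+* w.adicCompletion L) (algebraMap _ (w.adicCompletion L) r) = algebraMap _ _ (ψ r) := by
    refine ⟨RingEquiv.ofBijective
      (((τw : w.adicCompletion L →+* w.adicCompletion L).comp (w.adicCompletionIntegers L).subtype).codRestrict
        (w.adicCompletionIntegers L) (fun x ↦ ?_)) ⟨fun a b hab ↦ ?_, fun b ↦ ?_⟩, fun r ↦ rfl⟩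
    · exact (galAdicCompletionMap_mem_adicCompletionIntegers_iff (L := L) τ hτ (x : w.adicCompletion L)).mpr x.2
    · exact Subtype.ext (τw.injective (congrArg Subtype.val hab))
    · refine ⟨⟨τw.symm b, ?_⟩, Subtype.ext (τw.apply_symm_apply b)⟩
      rw [hτw, galAdicCompletionEquiv_symm_apply]
      exact (galAdicCompletionMap_mem_adicCompletionIntegers_iff (L := L) τ⁻¹ (inv_smul_eq_of_smul_eq hτ) (b : w.adicCompletion L)).mpr b.2
  have hE0 : ∀ R : Y.toAffine.Point, R ∈ Y.goodReductionSubgroup (w.adicCompletionIntegers L) →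
      mapPoint (τw : w.adicCompletion L →+* w.adicCompletion L) hT R ∈ Y.goodReductionSubgroup (w.adicCompletionIntegers L) := by
    intro R hR
    rw [WeierstrassCurve.mem_goodReductionSubgroup_iff_holds] at hR ⊢
    exact (Summit.BirchSwinnertonDyer.Rank1Residual.JET.isNonsingularReductionPoint_mapPoint_iff ψ τw hψ Y hT R).mpr hR
  -- `T ∘ ι = ι` on points and `T ∘ j = j ∘ τ`
  have hTι : ∀ Q₀ : (W.baseChange ((w.under (𝓞 ℚ)).adicCompletion ℚ)).toAffine.Point,
      mapPoint (τw : w.adicCompletion L →+* w.adicCompletion L) hT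
        (mapPoint (adicCompletionOfLiesOver ℚ L (w.under (𝓞 ℚ)) w) (baseChange_baseChange_eq_map_adicCompletionOfLiesOver W w).symm Q₀) =
      mapPoint (adicCompletionOfLiesOver ℚ L (w.under (𝓞 ℚ)) w) (baseChange_baseChange_eq_map_adicCompletionOfLiesOver W w).symm Q₀ := by
    rintro (_ | ⟨x, y, hxy⟩)
    · rfl
    · simp only [mapPoint_some]
      exact Affine.Point.some.injEq _ _ _ _ _ _ |>.mpr
        ⟨galAdicCompletionMap_adicCompletionOfLiesOver w τ hτ _, galAdicCompletionMap_adicCompletionOfLiesOver w τ hτ _⟩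
  have hTj : mapPoint (τw : w.adicCompletion L →+* w.adicCompletion L) hT (mapPoint (algebraMap L (w.adicCompletion L)) rfl P) =
      mapPoint (algebraMap L (w.adicCompletion L)) rfl (pointGalHom W L τ P) := by
    rcases P with _ | ⟨x, y, hxy⟩
    · rfl
    · rw [pointGalHom_apply, Affine.Point.map_some]
      simp only [mapPoint_some]
      exact Affine.Point.some.injEq _ _ _ _ _ _ |>.mpr
        ⟨galAdicCompletionMap_coe_algEquiv ℚ τ hτ _, galAdicCompletionMap_coe_algEquiv ℚ τ hτ _⟩
  -- (T_w) decomposition of the image of `P`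
  obtain ⟨Q₀, hQ₀⟩ := exists_sub_mapPoint_mem_goodReductionSubgroup W w q hqw he h3 (mapPoint (algebraMap L (w.adicCompletion L)) rfl P)
  have h1 := hE0 _ hQ₀
  rw [map_sub, hTι, hTj] at h1
  have h2 := (Y.goodReductionSubgroup (w.adicCompletionIntegers L)).sub_mem h1 hQ₀
  rwa [sub_sub_sub_cancel_right] at h2

end Summit.BirchSwinnertonDyer.BirchSwinnertonDyer.Theorems.CarrierLocalE0

end
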